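import Literature.Probability.FitznerVanDerHofstad2017.MeanFieldD11AppDDischarged
import Literature.Probability.FitznerVanDerHofstad2017.MeanFieldD11Stage1TailsEvalU
import HarnessLib

/-!
# Mean-field behaviour at `d = 11` on the kernel App.-D line, IV: the (S2a′) hypotheses at the `U` twin (derivable polygon multiplicities)

CITATION HEADER (PLACEMENT v2). Part of the certified REPRODUCTION of R. Fitzner, R. van der Hofstad, *Mean-field behavior for
nearest-neighbor percolation in d > 10*, EJP 22 (2017) no. 43 [FvdH17] and *Generalized approach to the non-backtracking lace
expansion*, PTRF 169 (2017) 1041–1119 [NoBLE17]; build `lace`, seat lean2 (gen 13), LEMMAS §21 node N72(b) TRANCHE 2d (module 2b of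
GAPS 'lean2 gen 13 — AMENDMENT 2').  ADDITIVE companion of `MeanFieldD11AppD` / `MeanFieldD11AppDStage1` / `MeanFieldD11AppDFull`
(untouched): the same assembly with the Assumption-4.3 hypotheses stated at the outputs of the typed Stage-1 recipe OVER THE
DERIVABLE-MULTIPLICITY CELLS `Stage1Cells.Rec.U` (`Stage1Tails.Rec.U.inpMajQ dataHi P stateRec s SQrU SbQrU`, tails included) instead of
the coded record.  No record file, no published numeral, no certificate of record is changed; nothing here is a cited fact; no
`def … : Prop`.

WHY (GAPS AMENDMENT 2, DIVERGENCE D57, LEMMAS §21).  The printed derivation of [NoBLE17-I] §5.3 delivers the repulsive-polygon bounds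
with the DERIVABLE multiplicities (closed Triangle/Square one- and two-tail counts `C(n+1,2)`, additive open cells), which MAJORISE the
coded ones (`MeanFieldD11Stage1URecord`); so the (S2a′) hypothesis the derivation can actually discharge is the one at the `U` twin,
and `43At(U twin) ⇒ 43At(coded record)` is the available direction — not conversely.  This module therefore re-bases BOTH (S2a′)
binders of `meanField_d11_typedStage1` on the `U` twin.

WHAT IS PROVED.
1. Improvement point: `43At(p, S, inpMajQ…U .o) → 43At(p, S, inputsO)` (`nobleAssumption43At_inputsO_of_stage1FullU`, along
   `MeanFieldD11Stage1TailsEvalU.inpMajQU_hi_dom_o`: the inputs of record at `o` absorb the derivable multiplicities); the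
   improvement-step binder `nobleImprovementInputsAt_d11_typedU`.
2. Initial point: the inputs of record at `i` do NOT absorb them (`MeanFieldD11Stage1TailsEvalU`, header item 3: twenty-eight fields
   exceeded, by up to `1/30` relative).  As for `inputsI2` in module II, the transport goes through an AUXILIARY record:
   `D11.inputsIU` := `inputsI` with those twenty-eight fields multiplied by `1 + δ_f` (kernel brackets).  Proved here: `inputsI.Dom
   inputsIU` (weaker than the published record), signs and `NobleInputsWF 11 inputsIU`, (N1′) (N2) (N3) at `inputsIU`, `α_F^low(inputsIU)
   = α_F^low(inputsI)` (`rfl`: the fields it reads are untouched) and `β_Δ(inputsI) ≤ β_Δ(inputsIU)` (`norm_num` through the typed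
   (D.32)), hence the `F`-side hypothesis at the PUBLISHED `β(inputsI)` implies the one at `β(inputsIU)`; and — the load-bearing
   arithmetic — **the three initial-stage inequalities of the input-level certificate `P(γ, Γ)` STILL HOLD at `β(inputsIU)`**
   (`nobleCertificate_d11_inputsIU`: `Admissible`, `f₁-bound ≤ γ₁`, `f₂-bound ≤ γ₂` re-evaluated by `norm_num`; the published
   initial-stage margins `γ₁ − f₁(i) ≈ 1.6·10⁻³`, `γ₂ − f₂(i) ≈ 4.5·10⁻²` absorb the inflation; the six other certificate fields
   are those of `nobleCertificate_d11_inputs`).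
3. `meanField_d11_typedU` / `percolationContinuity_d11_typedU` / `meanField_full_d11_typedU : … → MeanField 11`: [FvdH17] Thm 1.1 /
   Cor. 1.3 at `d = 11` from (S2a′ at `p_I`) Assumption 4.3 with the constants `inpMajQ dataHi P stateRec .i SQrU SbQrU`, (S2a′) the
   same on the window with `… .o SQrU SbQrU`, (S2b) the Prop. 2.2 weighted-diagram bounds `bi`/`bo`, (F) App. D (D.3)+(D.32) at the
   PUBLISHED `β(inputsI)` / `β(inputsO)`.  Standard axioms.
4. (§7, composition with `MeanFieldD11AppDDischarged`) `meanField_full_d11_typedU_discharged : (S2a′ U cell i at p_I) → (S2b bi) →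
   (window: S2a′ U cell o ∧ S2b bo) → MeanField 11` — App. D DISCHARGED (module 3c-B `nobleSimplifiedFormAt_percolation₅`, table `β^corr`
   of DIVERGENCE D65, free parameter `γ' = gammaD65`; certificate `nobleCertificate_d11_corrIU` by `norm_num`): no App.-D hypothesis, no
   published Stage-1 decimal in a hypothesis.
SCOPE (REFEREE R288 (a)(iii) / W51.1 caveat, stated for THIS sentence).  (S2a′) is displayed at the typed Stage-1 recipe over
`Stage1Cells.Rec.U` / `Stage1Tails.Rec.U`: the cells of `Percolation.nb` 1–44 AS CODED (weighted bubble of record, printed hexagon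
exponent, the notebook's open-bubble remainder conventions, tails through their closed-form majorant) EXCEPT the four repulsive-polygon
cells, which carry the DERIVABLE multiplicities of HOME/DIVERGENCE.md D57 / LEMMAS §21 N72(b) (closed triangle / square one- and
two-tail unit counts, open cells on the K-branch; `MeanFieldD11Stage1URecord` records the difference to the coded cells at the
record).  It is the D57 twin announced in the SCOPE paragraph of `MeanFieldD11AppDStage1`; it is NOT the cited-class typing with the
Γ₂′ factors of DIVERGENCE D45 (lean1 R164), and nothing here asserts that any cell bounds the lattice quantity it names — that is the
derivation's content (N35′ + (T) + the polygon lemma), displayed here as the hypothesis it would discharge.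

EPISTEMIC STATUS.  `inputsIU` is a kernel device, not a table of [FvdH17]; the theorem says: IF the lace-expansion coefficients obey
Assumption 4.3 with the `U`-twin constants (what a completed derivation N35′ + (T) + the polygon lemma of LEMMAS §21 would give for
THIS typing of the recipe), THEN mean-field behaviour at `d = 11` follows by the published bootstrap with its published constants
`(γ, Γ, c_μ, c)` — the initial-stage check passing with room to spare.  It does not say the published initial-point table is
reproduced by the `U` twin (it is not: module `MeanFieldD11Stage1TailsEvalU`), and it is silent about every `d ≠ 11`.
FREE-PARAMETER CLAUSE for the §7 sentence (REFEREE2 ref2-R42/R43, REFEREE W54.2): on the App.-D-discharged line (table `β^corr`,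
DIVERGENCE D65) the record's free parameter `γ₂ = 1.108259` (`gammaC 1`) is INFEASIBLE — `f2Bound (β^corr(inputsO)) > γ₂` is the kernel
theorem `D11.f2BoundCorr_o_not_le_gammaC` (module `MeanFieldD11AppDCorr`) — and `γ'₂ = 1.10845` (`gammaD65 1`, inside
`[f2Bound(β^corr(inputsO)), Γ₂)`, `Γ₂ = 1.1084502`) is used instead; `γ₁`, `γ₃`, `Γ` are the record's.  §§1–6 use the record's `γ = gammaC`
unchanged (App. D displayed there as the hypotheses (F)).  The §7 sentence is NOT the certificate of record.

REVISION 2 (lean2 gen 14): module docstring and the §7 section header only (the free-parameter clause); no declaration, statement or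
proof changed.

f₃-TABLE CLAUSE (REFEREE v56 R319 (e) = ORDERS v56 W56.2; REFEREE2 v48 ref2-R44 (b)): `bo` here is rev 6's β_Δ-WIRED f₃
table (`Percolation.nb` cell [144] passes `1/(α_F,low − β_Δ)` as the last argument of every `s = o` `BoundFThreeBound` cell, so the six
`bo` literals are functions of `β_Δ`, while `bi` is not); the corrected chain's `b_o` at this cell (O12g U(12,28)) exceeds `c001` on
engine B (finding C46-F3, ONE engine: `b_o,{0,0,1}/c001 = 1.000103` as coded, `1.000080` printed wiring, `> Γ₃ = 1`), so this is the
KERNEL SHAPE of the D65 certificate, not its corrected numerics — closing requires Cert rev 7 (O12g U(13,28), fallback O12h-B; two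
engines; C46 BLOCKING).  In particular NO sentence of this module says that `P(γ', Γ)` holds at `β^corr` with CORRECTED f₃ tables:
the kernel theorems below pair `β^corr(inputsO)` with the rev-6 `bo` literal, exactly as typed (valid as typed, R319 (e)).
REVISION 3 (lean2 gen 14, W56.2): module docstring and the §7 section header only (the f₃-table clause); every declaration byte-identical to
revision 1 (p187837); revision 2 (p188363) added the free-parameter clause.

[cite: FitznerVanDerHofstad2017, Thm 1.1 / Cor. 1.3 (d = 11), §2.5–§2.7; notebook Percolation.nb cells 41–44]
[cite: FitznerVanDerHofstad2016NoBLE, Thm 2.10, Prop. 2.11, Prop. 4.5, Assumption 4.3, App. D (D.1)–(D.32) pp. 1110–1118]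
-/

namespace Literature.Probability.FitznerVanDerHofstad2017

open _root_.MeasureTheory _root_.Filter _root_.Topology Literature.Probability.LatticeModels
open Literature.Barriers.CriticalPhenomena Literature.Probability.Percolation
open scoped BigOperators

namespace D11

open NoGoFrame Stage1Cells Stage1Cells.CertD11RecU
open Stage1Cells.CertD11 (P dataHi)
open Stage1Cells.CertD11Rec (stateRec)
open Stage1Tails.Rec.U (inpMajQ)

/-! ## 1. Improvement point: (S2a′) at the `U` twin transports to `inputsO` -/

/-- **(S2a) transport, improvement point, the `U`-twin record WITH TAILS.**  Assumption 4.3 at `(11, p, S)` with the constants computed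
by the typed Stage-1 recipe over the derivable-multiplicity polygons (tails included, exact Neumann inverses `SQrU`, `SbQrU`) from the
certified tables at the O12g state implies Assumption 4.3 with the published `inputsO` (kernel: `inpMajQU_hi_dom_o`, `inputsO_WF`,
`NobleAssumption43At.of_dom`). [cite: FitznerVanDerHofstad2016NoBLE, Assumption 4.3 pp. 1086–1088] -/
theorem nobleAssumption43At_inputsO_of_stage1FullU {p : unitInterval} {S : NobleSplit 11 p}
    (h : NobleAssumption43At 11 p S (inpMajQ dataHi P stateRec .o SQrU SbQrU)) : NobleAssumption43At 11 p S inputsO :=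
  nobleAssumption43At_inputsO_of_dom inpMajQU_hi_dom_o h

/-- **The improvement-step oracle binder at `d = 11`, (S2a′) at the `U` twin's outputs (with tails).**
[cite: FitznerVanDerHofstad2016NoBLE, Prop. 4.5 (p. 1088); Assumption 4.3] [cite: FitznerVanDerHofstad2017, Prop. 2.2 (EJP p. 11); §§4–6] -/
theorem nobleImprovementInputsAt_d11_typedU
    (hS : ∀ (p : unitInterval) (hp : p ∈ Set.Ioo (nbwThresholdI 11) (criticalProbI 11)),
      (∀ j, Literature.Barriers.CriticalPhenomena.nobleF 11 cMuC cWeightsC j p ≤ GammaC j) →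
        NobleAssumption43At 11 p (percolationNobleSplit 11 p two_le_eleven hp.2) (inpMajQ dataHi P stateRec .o SQrU SbQrU) ∧
        (∀ k ∈ cube 11,
          ((BetaMap.nobleBetaOfInputs ((11 : ℕ) : ℝ) inputsO).αFlow -
              (BetaMap.nobleBetaOfInputs ((11 : ℕ) : ℝ) inputsO).βΔ) * (1 - Dhat 11 k) ≤
            cosFT (nobleF 11 p) 0 - cosFT (nobleF 11 p) k) ∧
        NobleWeightedDiagramBoundAt 11 p bo) :
    NobleImprovementInputsAt 11 cMuC cWeightsC GammaC (BetaMap.nobleBetaOfInputs 11 inputsO) bo :=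
  nobleImprovementInputsAt_d11_appD fun p hp hΓ =>
    let ⟨h43, hF, hW⟩ := hS p hp hΓ
    ⟨nobleAssumption43At_inputsO_of_stage1FullU h43, hF, hW⟩

/-! ## 2. Initial point: the auxiliary record `inputsIU` -/

set_option maxHeartbeats 4000000 in
/-- `inputsIU` is dominated by (is weaker than) the published record `inputsI`: thirty-two fields equal, twenty-eight larger. [folklore] -/
theorem inputsI_dom_inputsIU : inputsI.Dom inputsIU where
  mu := le_rfl
  muMin := le_rfl
  mubOverMu := le_rfl
  mub := le_rfl
  xiAlphaOneMinusZeroAtZero := le_rfl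
  xiAlphaZeroMinusOneAtZero := le_rfl
  xiAlphaOneMinusZeroAtEi := le_rfl
  xiAlphaZeroMinusOneAtEi := le_rfl
  xiIotaAlphaIAtEi := le_rfl
  xiIotaAlphaIIAtZero := le_rfl
  xiIotaAlphaISumAroundEi := le_rfl
  xiIotaAlphaIISumAroundZero := le_rfl
  psiAlphaIOneMinusZeroAroundEi := le_rfl
  psiAlphaIIZeroMinusOneAroundZero := le_rfl
  psiAlphaIZeroMinusOneAroundEi := le_rfl
  psiAlphaIIOneMinusZeroAroundZero := le_rfl
  piAlpha := le_rfl
  piAlphaLower := le_rfl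
  piOneLower := le_rfl
  psiZeroLower := le_rfl
  xiAbs := by norm_num [inputsIU, inputsI]
  xiOdd := by norm_num [inputsIU, inputsI]
  xiEven := by norm_num [inputsIU, inputsI]
  xiEvenTail := by norm_num [inputsIU, inputsI]
  xiOddTail := by norm_num [inputsIU, inputsI]
  xiR0 := le_rfl
  xiR1 := by norm_num [inputsIU, inputsI]
  xiR0Delta := le_rfl
  xiR1Delta := by norm_num [inputsIU, inputsI]
  xiDeltaAbs := by norm_num [inputsIU, inputsI]
  xiOddDelta := by norm_num [inputsIU, inputsI]
  xiEvenDelta := by norm_num [inputsIU, inputsI]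
  xiOddTailDelta := by norm_num [inputsIU, inputsI]
  xiEvenTailDelta := by norm_num [inputsIU, inputsI]
  psiRI0 := le_rfl
  psiRI1 := by norm_num [inputsIU, inputsI]
  psiRII0 := le_rfl
  psiRII1 := by norm_num [inputsIU, inputsI]
  psiRI0Delta := le_rfl
  psiRI1Delta := by norm_num [inputsIU, inputsI]
  psiRII0Delta := le_rfl
  psiRII1Delta := by norm_num [inputsIU, inputsI]
  piR0 := le_rfl
  piR0DeltaEiEk := le_rfl
  xiIotaAbs := by norm_num [inputsIU, inputsI]
  xiIotaOdd := by norm_num [inputsIU, inputsI]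
  xiIotaEven := by norm_num [inputsIU, inputsI]
  xiIotaEvenTail := by norm_num [inputsIU, inputsI]
  xiIotaRI0 := le_rfl
  xiIotaRII0 := le_rfl
  xiIotaDeltaEi := by norm_num [inputsIU, inputsI]
  xiIotaOddDeltaEi := by norm_num [inputsIU, inputsI]
  xiIotaEvenDeltaEi := by norm_num [inputsIU, inputsI]
  xiIotaEvenTailDeltaEi := by norm_num [inputsIU, inputsI]
  xiIotaDeltaZero := by norm_num [inputsIU, inputsI]
  xiIotaOddDeltaZero := by norm_num [inputsIU, inputsI]
  xiIotaEvenDeltaZero := by norm_num [inputsIU, inputsI]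
  xiIotaEvenTailDeltaZero := by norm_num [inputsIU, inputsI]
  xiIotaRI0DeltaEi := le_rfl
  xiIotaRII0DeltaZero := le_rfl

set_option maxHeartbeats 4000000 in
/-- sign facts of `inputsIU`. [folklore] -/
theorem inputsIU_nonneg : BetaMap.Inputs.Nonneg inputsIU := by
  constructor <;> norm_num [inputsIU, inputsI]

set_option maxHeartbeats 4000000 in
/-- `inputsIU` is well formed (`NobleInputsWF 11`): signs, `0 ≤ μ < 1`, `0 ≤ β̲_μ`, the geometric ratio `2d·μ̄/(1−μ)·β^abs_{Ξ^ι} < 1`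
(the inflated `xiIotaAbs` moves it from `0.00378…` by the factor `1 + 1/300`), `β_μ ≥ 1`, `β̲_μ > 0`. [cite: FitznerVanDerHofstad2016NoBLE, Assumption 4.3 (4.30) p. 1086; App. D (D.21), (D.29), (D.32)] -/
theorem inputsIU_WF : NobleInputsWF 11 inputsIU :=
  ⟨⟨inputsIU_nonneg, by norm_num [inputsIU, inputsI], by norm_num [inputsIU, inputsI], by norm_num [inputsIU, inputsI],
      by norm_num [inputsIU, inputsI]⟩, by norm_num [inputsIU, inputsI], by norm_num [inputsIU, inputsI]⟩

/-- **(S2a) transport, initial point, the `U`-twin record WITH TAILS, to the auxiliary record `inputsIU`** (kernel: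
`inpMajQU_hi_dom_iU`). [cite: FitznerVanDerHofstad2016NoBLE, Assumption 4.3 pp. 1086–1088 (z = z_I)] -/
theorem nobleAssumption43At_inputsIU_of_stage1FullU {p : unitInterval} {S : NobleSplit 11 p}
    (h : NobleAssumption43At 11 p S (inpMajQ dataHi P stateRec .i SQrU SbQrU)) : NobleAssumption43At 11 p S inputsIU :=
  h.of_dom inpMajQU_hi_dom_iU inputsIU_WF.1

/-- Assumption 4.3 with the PUBLISHED initial-point constants also implies it with `inputsIU` (`inputsI_dom_inputsIU`). [folklore] -/
theorem nobleAssumption43At_inputsIU_of_inputsI {p : unitInterval} {S : NobleSplit 11 p}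
    (h : NobleAssumption43At 11 p S inputsI) : NobleAssumption43At 11 p S inputsIU :=
  h.of_dom inputsI_dom_inputsIU inputsIU_WF.1

/-- (N1′) at `inputsIU` (the fields entering `c_Φ^low` are those of `inputsI`). [cite: FitznerVanDerHofstad2016NoBLE, App. D (D.9)–(D.10) p. 1111] -/
theorem n1_inputsIU :
    0 ≤ BetaMap.betaCPhiLow ((11 : ℕ) : ℝ) inputsIU.mu inputsIU.xiAlphaOneMinusZeroAtZero inputsIU.xiIotaAlphaIAtEi :=
  n1_inputsI

set_option maxHeartbeats 4000000 in
/-- (N2) at `inputsIU`: `β^abs_Ξ + β^abs_{Ξ^ι} < 1` with both fields inflated by `1 + 1/300`. [cite: FitznerVanDerHofstad2016NoBLE, App. D Step 2 p. 1111] -/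
theorem n2_inputsIU : inputsIU.xiAbs + inputsIU.xiIotaAbs < 1 := by norm_num [inputsIU, inputsI]

set_option maxHeartbeats 4000000 in
/-- (N3) at `inputsIU`: `β_Ψ̂ < 1` (reads the inflated `xiOdd`). [cite: FitznerVanDerHofstad2016NoBLE, App. D (D.4)–(D.5) p. 1110–1111] -/
theorem n3_inputsIU : (BetaMap.nobleBetaOfInputs ((11 : ℕ) : ℝ) inputsIU).βΨ < 1 := by
  norm_num [BetaMap.nobleBetaOfInputs, BetaMap.betaPsiHatLower, inputsIU, inputsI]

/-- `α_F^low` does not read any inflated field (`muMin`, `mu`, `psiAlpha…`, `piAlpha` only). [folklore] -/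
theorem beta_inputsIU_αFlow :
    (BetaMap.nobleBetaOfInputs ((11 : ℕ) : ℝ) inputsIU).αFlow = (BetaMap.nobleBetaOfInputs ((11 : ℕ) : ℝ) inputsI).αFlow := rfl

set_option maxHeartbeats 4000000 in
/-- `β_Δ(inputsI) ≤ β_Δ(inputsIU)` (kernel `norm_num` through the typed (D.32) at both records). [cite: FitznerVanDerHofstad2016NoBLE, App. D (D.32) p. 1117] -/
theorem beta_inputsI_βΔ_le_inputsIU :
    (BetaMap.nobleBetaOfInputs ((11 : ℕ) : ℝ) inputsI).βΔ ≤ (BetaMap.nobleBetaOfInputs ((11 : ℕ) : ℝ) inputsIU).βΔ := by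
  norm_num [BetaMap.nobleBetaOfInputs, BetaMap.betaRfDeltaLower, inputsIU, inputsI]

/-- **The `F`-side dispersive hypothesis at the PUBLISHED `β(inputsI)` implies the one at `β(inputsIU)`** (`α_F^low` equal, `β_Δ`
larger, `1 − D̂ ≥ 0`). [cite: FitznerVanDerHofstad2016NoBLE, App. D (D.3)+(D.32)] -/
theorem fSide_inputsIU_of_inputsI
    (hF : ∀ k ∈ cube 11,
      ((BetaMap.nobleBetaOfInputs ((11 : ℕ) : ℝ) inputsI).αFlow - (BetaMap.nobleBetaOfInputs ((11 : ℕ) : ℝ) inputsI).βΔ) *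
        (1 - Dhat 11 k) ≤ cosFT (nobleF 11 (nbwThresholdI 11)) 0 - cosFT (nobleF 11 (nbwThresholdI 11)) k) :
    ∀ k ∈ cube 11,
      ((BetaMap.nobleBetaOfInputs ((11 : ℕ) : ℝ) inputsIU).αFlow - (BetaMap.nobleBetaOfInputs ((11 : ℕ) : ℝ) inputsIU).βΔ) *
        (1 - Dhat 11 k) ≤ cosFT (nobleF 11 (nbwThresholdI 11)) 0 - cosFT (nobleF 11 (nbwThresholdI 11)) k := by
  intro k hk
  refine le_trans (mul_le_mul_of_nonneg_right ?_ (one_sub_Dhat_nonneg k)) (hF k hk)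
  rw [beta_inputsIU_αFlow]
  exact sub_le_sub_left beta_inputsI_βΔ_le_inputsIU _

set_option maxHeartbeats 4000000 in
/-- **The input-level certificate with the auxiliary initial record `inputsIU`** (improvement stage = the record's `inputsO`): the
three initial-stage inequalities re-evaluated by `norm_num` through the typed App.-D map at the INFLATED record; the other six are
those of `nobleCertificate_d11_inputs`.  NOT a certificate of record. [cite: FitznerVanDerHofstad2017, §2.5–§2.7 (d = 11); FitznerVanDerHofstad2016NoBLE, App. D] -/
theorem nobleCertificate_d11_inputsIU :
    NobleNumericCertificate 11 cMuC cWeightsC gammaC GammaC (BetaMap.nobleBetaOfInputs 11 inputsIU)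
      (BetaMap.nobleBetaOfInputs 11 inputsO) bi bo where
  one_lt_cμ := nobleCertificate_d11_inputs.one_lt_cμ
  c_pos := nobleCertificate_d11_inputs.c_pos
  γ_lt_Γ := nobleCertificate_d11_inputs.γ_lt_Γ
  admissible_init := by norm_num [NobleBeta.Admissible, inputsIU, inputsI, BetaMap.nobleBetaOfInputs, BetaMap.betaMubarOverMu, BetaMap.betaCPhiUp, BetaMap.betaAfLow, BetaMap.betaapI, BetaMap.betaapII, BetaMap.betaPiHat, BetaMap.betaPsiHatLower, BetaMap.betaRp, BetaMap.betaRfDeltaLower]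
  admissible := nobleCertificate_d11_inputs.admissible
  f1Bound_init_le := by norm_num [NobleBeta.f1Bound, inputsIU, inputsI, cMuC, gammaC, max_def, BetaMap.nobleBetaOfInputs, BetaMap.betaMubarOverMu, BetaMap.betaCPhiUp, BetaMap.betaAfLow, BetaMap.betaapI, BetaMap.betaapII, BetaMap.betaPiHat, BetaMap.betaPsiHatLower, BetaMap.betaRp, BetaMap.betaRfDeltaLower]
  f2Bound_init_le := by norm_num [NobleBeta.f2Bound, inputsIU, inputsI, gammaC, max_def, BetaMap.nobleBetaOfInputs, BetaMap.betaMubarOverMu, BetaMap.betaCPhiUp, BetaMap.betaAfLow, BetaMap.betaapI, BetaMap.betaapII, BetaMap.betaPiHat, BetaMap.betaPsiHatLower, BetaMap.betaRp, BetaMap.betaRfDeltaLower]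
  f3_init_le := nobleCertificate_d11_inputs.f3_init_le
  f1Bound_le := nobleCertificate_d11_inputs.f1Bound_le
  f2Bound_le := nobleCertificate_d11_inputs.f2Bound_le
  f3_le := nobleCertificate_d11_inputs.f3_le

/-- [NoBLE17] (4.52) in `≤` form at `p_I` with the `β`-table of `inputsIU`. [cite: FitznerVanDerHofstad2016NoBLE, Prop. 4.5 (i) p. 1088; App. D] -/
theorem nobleSimplifiedFormAt_d11_iU
    (h43 : NobleAssumption43At 11 (nbwThresholdI 11)
      (percolationNobleSplit 11 (nbwThresholdI 11) two_le_eleven (nbwThresholdI_lt_criticalProbI two_le_eleven)) inputsIU)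
    (hF : ∀ k ∈ cube 11,
      ((BetaMap.nobleBetaOfInputs ((11 : ℕ) : ℝ) inputsIU).αFlow - (BetaMap.nobleBetaOfInputs ((11 : ℕ) : ℝ) inputsIU).βΔ) *
        (1 - Dhat 11 k) ≤ cosFT (nobleF 11 (nbwThresholdI 11)) 0 - cosFT (nobleF 11 (nbwThresholdI 11)) k) :
    NobleSimplifiedFormAt 11 (nbwThresholdI 11) (BetaMap.nobleBetaOfInputs ((11 : ℕ) : ℝ) inputsIU) :=
  have hp := nbwThresholdI_lt_criticalProbI two_le_eleven
  have hp0 : 0 < ((nbwThresholdI 11 : unitInterval) : ℝ) := nbwThresholdI_pos (by norm_num)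
  nobleSimplifiedFormAt_percolation two_le_eleven hp hp0 inputsIU_WF
    (percolationNobleEquationAt_of_summable two_le_eleven hp hp0 h43.xiAbs.2.1 fun ι => (h43.xiIotaAbs ι).2.1)
    h43 n1_inputsIU n2_inputsIU n3_inputsIU hF

/-- **The initial-step oracle binder at `d = 11` with the `β`-table of `inputsIU`, (S2a′) at the `U` twin's outputs WITH TAILS and the
`F`-side hypothesis at the PUBLISHED `β(inputsI)`.** [cite: FitznerVanDerHofstad2016NoBLE, Prop. 4.5 (p. 1088); Assumption 4.3 (z = z_I)]
[cite: FitznerVanDerHofstad2017, Prop. 2.2 (EJP p. 11); §§4–6] -/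
theorem nobleInitialInputsAt_d11_typedU
    (hI43 : NobleAssumption43At 11 (nbwThresholdI 11)
      (percolationNobleSplit 11 (nbwThresholdI 11) two_le_eleven (nbwThresholdI_lt_criticalProbI two_le_eleven))
      (inpMajQ dataHi P stateRec .i SQrU SbQrU))
    (hIF : ∀ k ∈ cube 11,
      ((BetaMap.nobleBetaOfInputs ((11 : ℕ) : ℝ) inputsI).αFlow - (BetaMap.nobleBetaOfInputs ((11 : ℕ) : ℝ) inputsI).βΔ) *
        (1 - Dhat 11 k) ≤ cosFT (nobleF 11 (nbwThresholdI 11)) 0 - cosFT (nobleF 11 (nbwThresholdI 11)) k)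
    (hIW : NobleWeightedDiagramBoundAt 11 (nbwThresholdI 11) bi) :
    NobleInitialInputsAt 11 (BetaMap.nobleBetaOfInputs 11 inputsIU) bi := by
  have hS := nobleSimplifiedFormAt_d11_iU (nobleAssumption43At_inputsIU_of_stage1FullU hI43) (fSide_inputsIU_of_inputsI hIF)
  simp only [Nat.cast_ofNat] at hS
  exact ⟨hS, hIW⟩

/-! ## 3. Mean-field behaviour at `d = 11`, both (S2a′) hypotheses at the `U` twin -/

/-- **Mean-field behaviour at `d = 11` on the kernel App.-D line with BOTH Assumption-4.3 hypotheses stated at the outputs of the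
typed Stage-1 recipe OVER THE DERIVABLE-MULTIPLICITY POLYGONS (tails included, certified SRW tables).**  SCOPE CAVEAT (R288 (a)(iii)):
the other Stage-1 cells are AS CODED (header SCOPE); nothing asserts that a cell bounds the lattice quantity it names.  REMAINING HYPOTHESES
(displayed, not citable as typed): (S2a′ at `p_I`) Assumption 4.3 for the percolation split at `p_I` with the constants
`inpMajQ dataHi P stateRec .i SQrU SbQrU`; (S2a′) the same on `(p_I, p_c)` under `f ≤ Γ` with `inpMajQ dataHi P stateRec .o SQrU SbQrU`;
(S2b) [FvdH17] Prop. 2.2's weighted-diagram bounds `bi`, `bo`; (F) App. D (D.3)+(D.32) at the PUBLISHED `β(inputsI)` / `β(inputsO)`.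
Assembly: at `o` the `U` twin is dominated by `inputsO` (`inpMajQU_hi_dom_o`), at `i` by the auxiliary `inputsIU`
(`inpMajQU_hi_dom_iU`); Assumption 4.3 is transported along both; the `F`-hypothesis at `β(inputsI)` implies the one at `β(inputsIU)`;
the certificate `P(γ, Γ)` holds at `(β(inputsIU), β(inputsO))` (`nobleCertificate_d11_inputsIU`, kernel); [NoBLE17] Thm 2.10 / Prop. 2.11
(`meanField_of_certificate`).
[cite: FitznerVanDerHofstad2017, Thm 1.1 / Cor. 1.3 (d = 11: the bootstrap inequalities re-evaluated with certified arithmetic; analytic hypotheses typed, see header)]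
[cite: FitznerVanDerHofstad2016NoBLE, Thm 2.10, Prop. 2.11, Prop. 4.5, App. D] -/
theorem meanField_d11_typedU
    (hI43 : NobleAssumption43At 11 (nbwThresholdI 11)
      (percolationNobleSplit 11 (nbwThresholdI 11) two_le_eleven (nbwThresholdI_lt_criticalProbI two_le_eleven))
      (inpMajQ dataHi P stateRec .i SQrU SbQrU))
    (hIF : ∀ k ∈ cube 11,
      ((BetaMap.nobleBetaOfInputs ((11 : ℕ) : ℝ) inputsI).αFlow - (BetaMap.nobleBetaOfInputs ((11 : ℕ) : ℝ) inputsI).βΔ) *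
        (1 - Dhat 11 k) ≤ cosFT (nobleF 11 (nbwThresholdI 11)) 0 - cosFT (nobleF 11 (nbwThresholdI 11)) k)
    (hIW : NobleWeightedDiagramBoundAt 11 (nbwThresholdI 11) bi)
    (hS : ∀ (p : unitInterval) (hp : p ∈ Set.Ioo (nbwThresholdI 11) (criticalProbI 11)),
      (∀ j, Literature.Barriers.CriticalPhenomena.nobleF 11 cMuC cWeightsC j p ≤ GammaC j) →
        NobleAssumption43At 11 p (percolationNobleSplit 11 p two_le_eleven hp.2) (inpMajQ dataHi P stateRec .o SQrU SbQrU) ∧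
        (∀ k ∈ cube 11,
          ((BetaMap.nobleBetaOfInputs ((11 : ℕ) : ℝ) inputsO).αFlow -
              (BetaMap.nobleBetaOfInputs ((11 : ℕ) : ℝ) inputsO).βΔ) * (1 - Dhat 11 k) ≤
            cosFT (nobleF 11 p) 0 - cosFT (nobleF 11 p) k) ∧
        NobleWeightedDiagramBoundAt 11 p bo) :
    TriangleCondition 11 ∧ PercolationContinuity 11 ∧ BetaEqOneBoundedRatio 11 :=
  meanField_of_certificate (by norm_num) nobleCertificate_d11_inputsIU (nobleInitialInputsAt_d11_typedU hI43 hIF hIW)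
    (nobleImprovementInputsAt_d11_typedU hS)

/-- `θ(p_c) = 0` on `ℤ^11`, both Assumption-4.3 hypotheses at the `U` twin (hypotheses as in `meanField_d11_typedU`).
[cite: FitznerVanDerHofstad2017, Cor. 1.3 (d = 11)] -/
theorem percolationContinuity_d11_typedU
    (hI43 : NobleAssumption43At 11 (nbwThresholdI 11)
      (percolationNobleSplit 11 (nbwThresholdI 11) two_le_eleven (nbwThresholdI_lt_criticalProbI two_le_eleven))
      (inpMajQ dataHi P stateRec .i SQrU SbQrU))
    (hIF : ∀ k ∈ cube 11,
      ((BetaMap.nobleBetaOfInputs ((11 : ℕ) : ℝ) inputsI).αFlow - (BetaMap.nobleBetaOfInputs ((11 : ℕ) : ℝ) inputsI).βΔ) *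
        (1 - Dhat 11 k) ≤ cosFT (nobleF 11 (nbwThresholdI 11)) 0 - cosFT (nobleF 11 (nbwThresholdI 11)) k)
    (hIW : NobleWeightedDiagramBoundAt 11 (nbwThresholdI 11) bi)
    (hS : ∀ (p : unitInterval) (hp : p ∈ Set.Ioo (nbwThresholdI 11) (criticalProbI 11)),
      (∀ j, Literature.Barriers.CriticalPhenomena.nobleF 11 cMuC cWeightsC j p ≤ GammaC j) →
        NobleAssumption43At 11 p (percolationNobleSplit 11 p two_le_eleven hp.2) (inpMajQ dataHi P stateRec .o SQrU SbQrU) ∧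
        (∀ k ∈ cube 11,
          ((BetaMap.nobleBetaOfInputs ((11 : ℕ) : ℝ) inputsO).αFlow -
              (BetaMap.nobleBetaOfInputs ((11 : ℕ) : ℝ) inputsO).βΔ) * (1 - Dhat 11 k) ≤
            cosFT (nobleF 11 p) 0 - cosFT (nobleF 11 p) k) ∧
        NobleWeightedDiagramBoundAt 11 p bo) :
    PercolationContinuity 11 :=
  (meanField_d11_typedU hI43 hIF hIW hS).2.1

/-- **[FvdH17] Cor. 1.3 at `d = 11` in full (`MeanField 11`: `θ(p_c) = 0 ∧ γ = 1 ∧ β = 1 ∧ δ = 2`, bounded-ratio sense), both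
Assumption-4.3 hypotheses at the `U` twin** (scope caveat as in `meanField_d11_typedU`: polygon cells with derivable multiplicities,
all other cells AS CODED); exponents by `meanField_of_triangle`. [cite: FitznerVanDerHofstad2017, Cor. 1.3 (d = 11), EJP p. 6] -/
theorem meanField_full_d11_typedU
    (hI43 : NobleAssumption43At 11 (nbwThresholdI 11)
      (percolationNobleSplit 11 (nbwThresholdI 11) two_le_eleven (nbwThresholdI_lt_criticalProbI two_le_eleven))
      (inpMajQ dataHi P stateRec .i SQrU SbQrU))
    (hIF : ∀ k ∈ cube 11,
      ((BetaMap.nobleBetaOfInputs ((11 : ℕ) : ℝ) inputsI).αFlow - (BetaMap.nobleBetaOfInputs ((11 : ℕ) : ℝ) inputsI).βΔ) *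
        (1 - Dhat 11 k) ≤ cosFT (nobleF 11 (nbwThresholdI 11)) 0 - cosFT (nobleF 11 (nbwThresholdI 11)) k)
    (hIW : NobleWeightedDiagramBoundAt 11 (nbwThresholdI 11) bi)
    (hS : ∀ (p : unitInterval) (hp : p ∈ Set.Ioo (nbwThresholdI 11) (criticalProbI 11)),
      (∀ j, Literature.Barriers.CriticalPhenomena.nobleF 11 cMuC cWeightsC j p ≤ GammaC j) →
        NobleAssumption43At 11 p (percolationNobleSplit 11 p two_le_eleven hp.2) (inpMajQ dataHi P stateRec .o SQrU SbQrU) ∧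
        (∀ k ∈ cube 11,
          ((BetaMap.nobleBetaOfInputs ((11 : ℕ) : ℝ) inputsO).αFlow -
              (BetaMap.nobleBetaOfInputs ((11 : ℕ) : ℝ) inputsO).βΔ) * (1 - Dhat 11 k) ≤
            cosFT (nobleF 11 p) 0 - cosFT (nobleF 11 p) k) ∧
        NobleWeightedDiagramBoundAt 11 p bo) :
    MeanField 11 :=
  meanField_of_triangle (by norm_num) (meanField_d11_typedU hI43 hIF hIW hS).1

/-- The `U`-twin window hypothesis implies the literal-record one (transport along `inpMajQU_hi_dom_o`), stated on its own. [cite: FitznerVanDerHofstad2016NoBLE, Assumption 4.3 (pp. 1086–1088)] -/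
theorem window_inputsO_of_typedU
    (hS : ∀ (p : unitInterval) (hp : p ∈ Set.Ioo (nbwThresholdI 11) (criticalProbI 11)),
      (∀ j, Literature.Barriers.CriticalPhenomena.nobleF 11 cMuC cWeightsC j p ≤ GammaC j) →
        NobleAssumption43At 11 p (percolationNobleSplit 11 p two_le_eleven hp.2) (inpMajQ dataHi P stateRec .o SQrU SbQrU) ∧
        (∀ k ∈ cube 11,
          ((BetaMap.nobleBetaOfInputs ((11 : ℕ) : ℝ) inputsO).αFlow -
              (BetaMap.nobleBetaOfInputs ((11 : ℕ) : ℝ) inputsO).βΔ) * (1 - Dhat 11 k) ≤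
            cosFT (nobleF 11 p) 0 - cosFT (nobleF 11 p) k) ∧
        NobleWeightedDiagramBoundAt 11 p bo) :
    ∀ (p : unitInterval) (hp : p ∈ Set.Ioo (nbwThresholdI 11) (criticalProbI 11)),
      (∀ j, Literature.Barriers.CriticalPhenomena.nobleF 11 cMuC cWeightsC j p ≤ GammaC j) →
        NobleAssumption43At 11 p (percolationNobleSplit 11 p two_le_eleven hp.2) inputsO ∧
        (∀ k ∈ cube 11,
          ((BetaMap.nobleBetaOfInputs ((11 : ℕ) : ℝ) inputsO).αFlow -
              (BetaMap.nobleBetaOfInputs ((11 : ℕ) : ℝ) inputsO).βΔ) * (1 - Dhat 11 k) ≤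
            cosFT (nobleF 11 p) 0 - cosFT (nobleF 11 p) k) ∧
        NobleWeightedDiagramBoundAt 11 p bo := by
  intro p hp hf
  obtain ⟨h43, hF, hW⟩ := hS p hp hf
  exact ⟨nobleAssumption43At_inputsO_of_stage1FullU h43, hF, hW⟩


/-! ## 7. App. D DISCHARGED at the `U` twin: `MeanField 11` from (S2a′ at the `U` cells) + (S2b) alone

Composition with `MeanFieldD11AppDDischarged` (module VII: `nobleSimplifiedFormAt_percolation₅` of module 3c-B — all App.-D constants
constructed, (D.2)(D.3)(D.4)(D.14)(D.32) proved, table `β^corr` = DIVERGENCE D65 — and the certificate `P(γ', Γ)` at the `β^corr` tables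
with the free parameter `γ' = gammaD65`, module VI).  New arithmetic: `P(γ', Γ)` at `(β^corr(inputsIU), β^corr(inputsO))`
(`nobleCertificate_d11_corrIU`).  The resulting sentence carries NO App.-D hypothesis and NO published Stage-1 decimal: its displayed
binders are (S2a′) Assumption 4.3 at the `U`-twin cells (point `i` at `p_I`, point `o` on the window) and (S2b) Prop. 2.2.  SCOPE and
EPISTEMIC STATUS as in the module docstring, plus: D65 table and `γ'` — NOT the certificate of record.  FREE-PARAMETER CLAUSE (ref2-R42/R43):
the record's free `γ₂ = 1.108259` (`gammaC 1`) is infeasible on this line (`D11.f2BoundCorr_o_not_le_gammaC`); `γ'₂ = 1.10845` (`gammaD65 1`)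
is used.  f₃-TABLE CLAUSE (W56.2 / ref2-R44 (b)): `bo` below is rev 6's β_Δ-wired f₃ table; the corrected chain's `b_o` at this cell
exceeds `c001` on engine B (C46-F3), so §7 is the kernel shape of the D65 certificate, not its corrected numerics — closing requires Cert
rev 7 (O12g U(13,28), fallback O12h-B; two engines). -/

/-- (N4) at `inputsIU` (`α̲_F` reads none of the twenty-eight inflated fields; = `n4_inputsI`). [cite: FitznerVanDerHofstad2016NoBLE, App. D (D.5) p. 1110] -/
theorem n4_inputsIU : 0 ≤ (BetaMap.nobleBetaOfInputs ((11 : ℕ) : ℝ) inputsIU).αFlow := by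
  rw [beta_inputsIU_αFlow]; exact n4_inputsI

set_option maxHeartbeats 4000000 in
/-- `f2Bound(β^corr(inputsIU)) ≤ 1.07`. [cite: FitznerVanDerHofstad2016NoBLE, Def. 2.9; Prop. 2.11 (f₂(z_I) ≤ γ₂)] -/
theorem f2BoundCorr_iU_le : (BetaMap.nobleBetaOfInputsCorr 11 inputsIU).f2Bound 11 ≤ 1.07 := by
  norm_num [NobleBeta.f2Bound, inputsIU, inputsI, max_def, BetaMap.nobleBetaOfInputsCorr, BetaMap.betaRfDeltaCorr, BetaMap.nobleBetaOfInputs, BetaMap.betaMubarOverMu, BetaMap.betaCPhiUp, BetaMap.betaAfLow, BetaMap.betaapI, BetaMap.betaapII, BetaMap.betaPiHat, BetaMap.betaPsiHatLower, BetaMap.betaRp, BetaMap.betaRfDeltaLower]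

set_option maxHeartbeats 4000000 in
/-- **`P(γ', Γ)` at `d = 11` for the tables `β^corr(inputsIU)`, `β^corr(inputsO)`** (`γ' = gammaD65`): initial-point admissibility and
`f₂`-condition by `norm_num`; `f₁` along `f1Bound_corr_eq` from `nobleCertificate_d11_inputsIU`; window fields, `f₃`, `c_μ`, `c`, `γ' < Γ`
from `nobleCertificate_d11_corr`.  NOT the certificate of record. [cite: FitznerVanDerHofstad2016NoBLE, Def. 2.9, Prop. 2.11] [cite: FitznerVanDerHofstad2017, §2.5–§2.7 (d = 11)] -/
theorem nobleCertificate_d11_corrIU :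
    NobleNumericCertificate 11 cMuC cWeightsC gammaD65 GammaC (BetaMap.nobleBetaOfInputsCorr 11 inputsIU)
      (BetaMap.nobleBetaOfInputsCorr 11 inputsO) bi bo where
  one_lt_cμ := nobleCertificate_d11_corr.one_lt_cμ
  c_pos := nobleCertificate_d11_corr.c_pos
  γ_lt_Γ := nobleCertificate_d11_corr.γ_lt_Γ
  admissible_init := by norm_num [NobleBeta.Admissible, inputsIU, inputsI, BetaMap.nobleBetaOfInputsCorr, BetaMap.betaRfDeltaCorr, BetaMap.nobleBetaOfInputs, BetaMap.betaMubarOverMu, BetaMap.betaCPhiUp, BetaMap.betaAfLow, BetaMap.betaapI, BetaMap.betaapII, BetaMap.betaPiHat, BetaMap.betaPsiHatLower, BetaMap.betaRp, BetaMap.betaRfDeltaLower]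
  admissible := nobleCertificate_d11_corr.admissible
  f1Bound_init_le := by rw [f1Bound_corr_eq, gammaD65_zero]; exact nobleCertificate_d11_inputsIU.f1Bound_init_le
  f2Bound_init_le := by rw [gammaD65_one]; norm_num [NobleBeta.f2Bound, inputsIU, inputsI, max_def, BetaMap.nobleBetaOfInputsCorr, BetaMap.betaRfDeltaCorr, BetaMap.nobleBetaOfInputs, BetaMap.betaMubarOverMu, BetaMap.betaCPhiUp, BetaMap.betaAfLow, BetaMap.betaapI, BetaMap.betaapII, BetaMap.betaPiHat, BetaMap.betaPsiHatLower, BetaMap.betaRp, BetaMap.betaRfDeltaLower]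
  f3_init_le := nobleCertificate_d11_corr.f3_init_le
  f1Bound_le := nobleCertificate_d11_corr.f1Bound_le
  f2Bound_le := nobleCertificate_d11_corr.f2Bound_le
  f3_le := nobleCertificate_d11_corr.f3_le

/-- [NoBLE17] Prop. 4.5(ii) at `p_I` with the auxiliary record `inputsIU`, App. D DISCHARGED (table `β^corr(inputsIU)`).
[cite: FitznerVanDerHofstad2016NoBLE, Prop. 4.5 (p. 1088); Assumption 4.3 (z = z_I); App. D] [cite: FitznerVanDerHofstad2017, §2.4–§2.5] -/
theorem nobleSimplifiedFormAt_d11_iU₅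
    (h43 : NobleAssumption43At 11 (nbwThresholdI 11)
      (percolationNobleSplit 11 (nbwThresholdI 11) two_le_eleven (nbwThresholdI_lt_criticalProbI two_le_eleven)) inputsIU) :
    NobleSimplifiedFormAt 11 (nbwThresholdI 11) (BetaMap.nobleBetaOfInputsCorr ((11 : ℕ) : ℝ) inputsIU) :=
  have hp := nbwThresholdI_lt_criticalProbI two_le_eleven
  have hp0 : 0 < ((nbwThresholdI 11 : unitInterval) : ℝ) := nbwThresholdI_pos (by norm_num)
  nobleSimplifiedFormAt_percolation₅ two_le_eleven hp hp0 inputsIU_WF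
    (percolationNobleEquationAt_of_summable two_le_eleven hp hp0 h43.xiAbs.2.1 fun ι => (h43.xiIotaAbs ι).2.1)
    h43 n1_inputsIU n2_inputsIU n3_inputsIU n4_inputsIU

/-- **Initial-step binder at `d = 11` from (S2a′) at the `U`-twin cell (point `i`, tails) and (S2b) `bi`, App. D discharged**
(transport `U cell ≤ inputsIU`: `nobleAssumption43At_inputsIU_of_stage1FullU`). [cite: FitznerVanDerHofstad2016NoBLE, Prop. 4.5, Prop. 2.11] [cite: FitznerVanDerHofstad2017, Prop. 2.2; §§4–6] -/
theorem nobleInitialInputsAt_d11_typedU_discharged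
    (hI43 : NobleAssumption43At 11 (nbwThresholdI 11)
      (percolationNobleSplit 11 (nbwThresholdI 11) two_le_eleven (nbwThresholdI_lt_criticalProbI two_le_eleven))
      (inpMajQ dataHi P stateRec .i SQrU SbQrU))
    (hIW : NobleWeightedDiagramBoundAt 11 (nbwThresholdI 11) bi) :
    NobleInitialInputsAt 11 (BetaMap.nobleBetaOfInputsCorr 11 inputsIU) bi := by
  have hS := nobleSimplifiedFormAt_d11_iU₅ (nobleAssumption43At_inputsIU_of_stage1FullU hI43)
  simp only [Nat.cast_ofNat] at hS
  exact ⟨hS, hIW⟩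

/-- **Improvement-step binder at `d = 11` from (S2a′) at the `U`-twin cell (point `o`, tails) and (S2b) `bo` on the window, App. D
discharged** (transport `U cell ≤ inputsO`: `nobleAssumption43At_inputsO_of_stage1FullU`). [cite: FitznerVanDerHofstad2016NoBLE, Prop. 4.5, Prop. 2.11] [cite: FitznerVanDerHofstad2017, Prop. 2.2; §§4–6] -/
theorem nobleImprovementInputsAt_d11_typedU_discharged
    (hS : ∀ (p : unitInterval) (hp : p ∈ Set.Ioo (nbwThresholdI 11) (criticalProbI 11)),
      (∀ j, Literature.Barriers.CriticalPhenomena.nobleF 11 cMuC cWeightsC j p ≤ GammaC j) →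
        NobleAssumption43At 11 p (percolationNobleSplit 11 p two_le_eleven hp.2) (inpMajQ dataHi P stateRec .o SQrU SbQrU) ∧
        NobleWeightedDiagramBoundAt 11 p bo) :
    NobleImprovementInputsAt 11 cMuC cWeightsC GammaC (BetaMap.nobleBetaOfInputsCorr 11 inputsO) bo :=
  nobleImprovementInputsAt_d11_discharged fun p hp hΓ =>
    let ⟨h43, hW⟩ := hS p hp hΓ
    ⟨nobleAssumption43At_inputsO_of_stage1FullU h43, hW⟩

/-- **Mean-field behaviour at `d = 11` — App. D discharged, both Assumption-4.3 hypotheses at the `U`-twin Stage-1 cells (derivable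
repulsive-polygon multiplicities, tails, certified SRW tables).**  REMAINING HYPOTHESES (ANALYTIC, NOT CITABLE as typed; no named fact):
(S2a′) at `p_I` with the `U` cell at `i`; (S2a′) on `(p_I, p_c)` under `f ≤ Γ` with the `U` cell at `o`; (S2b) [FvdH17] Prop. 2.2's `bi`, `bo`.
SCOPE: module docstring (cells as coded except the four repulsive-polygon cells at the derivable multiplicities; nothing asserts a cell
bounds its lattice quantity); D65 table `β^corr`, free parameter `γ'` — not the certificate of record.
[cite: FitznerVanDerHofstad2017, Thm 1.1 / Cor. 1.3 (d = 11)] [cite: FitznerVanDerHofstad2016NoBLE, Thm 2.10, Prop. 2.11, Prop. 4.5, App. D] -/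
theorem meanField_d11_typedU_discharged
    (hI43 : NobleAssumption43At 11 (nbwThresholdI 11)
      (percolationNobleSplit 11 (nbwThresholdI 11) two_le_eleven (nbwThresholdI_lt_criticalProbI two_le_eleven))
      (inpMajQ dataHi P stateRec .i SQrU SbQrU))
    (hIW : NobleWeightedDiagramBoundAt 11 (nbwThresholdI 11) bi)
    (hS : ∀ (p : unitInterval) (hp : p ∈ Set.Ioo (nbwThresholdI 11) (criticalProbI 11)),
      (∀ j, Literature.Barriers.CriticalPhenomena.nobleF 11 cMuC cWeightsC j p ≤ GammaC j) →
        NobleAssumption43At 11 p (percolationNobleSplit 11 p two_le_eleven hp.2) (inpMajQ dataHi P stateRec .o SQrU SbQrU) ∧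
        NobleWeightedDiagramBoundAt 11 p bo) :
    TriangleCondition 11 ∧ PercolationContinuity 11 ∧ BetaEqOneBoundedRatio 11 :=
  meanField_of_certificate (by norm_num) nobleCertificate_d11_corrIU (nobleInitialInputsAt_d11_typedU_discharged hI43 hIW)
    (nobleImprovementInputsAt_d11_typedU_discharged hS)

/-- `θ(p_c) = 0` on `ℤ^11` (hypotheses as in `meanField_d11_typedU_discharged`). [cite: FitznerVanDerHofstad2017, Cor. 1.3 (d = 11)] -/
theorem percolationContinuity_d11_typedU_discharged
    (hI43 : NobleAssumption43At 11 (nbwThresholdI 11)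
      (percolationNobleSplit 11 (nbwThresholdI 11) two_le_eleven (nbwThresholdI_lt_criticalProbI two_le_eleven))
      (inpMajQ dataHi P stateRec .i SQrU SbQrU))
    (hIW : NobleWeightedDiagramBoundAt 11 (nbwThresholdI 11) bi)
    (hS : ∀ (p : unitInterval) (hp : p ∈ Set.Ioo (nbwThresholdI 11) (criticalProbI 11)),
      (∀ j, Literature.Barriers.CriticalPhenomena.nobleF 11 cMuC cWeightsC j p ≤ GammaC j) →
        NobleAssumption43At 11 p (percolationNobleSplit 11 p two_le_eleven hp.2) (inpMajQ dataHi P stateRec .o SQrU SbQrU) ∧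
        NobleWeightedDiagramBoundAt 11 p bo) :
    PercolationContinuity 11 :=
  (meanField_d11_typedU_discharged hI43 hIW hS).2.1

/-- **[FvdH17] Cor. 1.3 at `d = 11` in full (`MeanField 11`) — App. D discharged, (S2a′) at the `U`-twin cells, (S2b)** (hypotheses
and SCOPE as in `meanField_d11_typedU_discharged`; exponents by `meanField_of_triangle`). [cite: FitznerVanDerHofstad2017, Cor. 1.3 (d = 11), EJP p. 6] -/
theorem meanField_full_d11_typedU_discharged
    (hI43 : NobleAssumption43At 11 (nbwThresholdI 11)
      (percolationNobleSplit 11 (nbwThresholdI 11) two_le_eleven (nbwThresholdI_lt_criticalProbI two_le_eleven))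
      (inpMajQ dataHi P stateRec .i SQrU SbQrU))
    (hIW : NobleWeightedDiagramBoundAt 11 (nbwThresholdI 11) bi)
    (hS : ∀ (p : unitInterval) (hp : p ∈ Set.Ioo (nbwThresholdI 11) (criticalProbI 11)),
      (∀ j, Literature.Barriers.CriticalPhenomena.nobleF 11 cMuC cWeightsC j p ≤ GammaC j) →
        NobleAssumption43At 11 p (percolationNobleSplit 11 p two_le_eleven hp.2) (inpMajQ dataHi P stateRec .o SQrU SbQrU) ∧
        NobleWeightedDiagramBoundAt 11 p bo) :
    MeanField 11 :=
  meanField_of_triangle (by norm_num) (meanField_d11_typedU_discharged hI43 hIW hS).1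

end D11

end Literature.Probability.FitznerVanDerHofstad2017
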